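/-
Copyright: the b2b-balaban cell (near-miss cell 7), T⁴-continuum CRUX team (coordinator ruling e34b3e0c item (2)),
lineage t4-ne7b-formalise-leaf-04 (gen 26). Released under the licence of the surrounding project.
-/
import Literature.MathematicalPhysics.QuantumFieldTheory.Balaban1983to89.T4WeightBudget
import HarnessLib

/-!
# The K₀-PREFIX patch (R-K₀): NE7b's output shape with the bad classes KEPT AT EVERY CUTOFF — an eventual
# `RelWeightBound` plus a trivial sup-ratio below `K₀` is a `RelWeightBound` on all `K` (crux refuter's PRICING-NE7b
# v4 F18, «NE7 side CONCURRED»; crux-route work under `Spine/NE7b/`, cross-node NE7b → NE7)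

Cell `pub-balaban`, sub-cell `t4`, spine estimate NE7b (node U5c).  Every kernel END of the two candidate roads of
record — the COUNT road (`…Support.CountThreshold*`, `…HistoryRealiseCellsRun*`) and route R-H «Peierls healing map»
(`…NE7b.HealingMap.relWeightBound_of_healing`, `…exists_relWeightBound_of_healing_count`, leaf-05's set-valued
twins) — delivers NE7b's output shape through the tree's `T4WeightBudget.relWeightBound_of_eventually`, i.e. as
`RelWeightBound l₀ T A B (fun K t => if K₀ ≤ K then Bad K t else ∅) W`: the bad classes are EMPTIED below the
cutoff `K₀` from which the weight majorant is `< 1`.  The NE7b crux refuter LOCATED the cost of that convenience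
(PRICING-NE7b v4 F18, the «K₀-SHIFT», cross-node): NE7's consumer
`T4WeightBudget.cauchySum_of_crossover_relWeightBound` then needs its term-wise sandwich `hgood` for EVERY term of
`T K` at `K < K₀` — the old pending structure that NE7b exists to remove from `hgood` is handed back to NE7 on a prefix
of cutoffs growing like `log |T₁|` (F17).  The refuter's recommended SUPPLIER-SIDE patch (R-K₀): «keep `Bad` at all
`K` and fill `W K` for `K < K₀` with the trivial sup-ratio (`< 1` because the no-large-field term has `A, B > 0` at
every `|t| ≤ l₀` and `t ↦ A, B` are continuous on `[−l₀, l₀]`); `summable` is untouched (finite prefix)».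

THIS FILE is that patch, kernel-checked ([folklore] finite sums + one compactness argument; zero `sorry`; nothing of
Bałaban's asserted; no `def … : Prop`; imports `T4WeightBudget` + `HarnessLib` only):
* §1 **`relWeightBound_of_eventually_of_prefix`** — an eventual `RelWeightBound` (bad classes emptied below `K₀`,
  ANY weight `W`) + for `K < K₀` the two relative bounds with prefix weights `0 ≤ W₀ K < 1` ⟹
  `RelWeightBound l₀ T A B Bad (fun K => if K₀ ≤ K then W K else W₀ K)`: the bad classes KEPT at every `K`;
  summability by `summable_nat_add_iff` (finite prefix).  `relWeightBound_of_eventually_of_floor`: the same from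
  prefix bounds stated at ALL `K`.
* §2 **`sum_le_one_sub_mul_sum_of_floor`** — THE TRIVIAL SUP-RATIO: a never-bad term `τ₀ ∈ T ∖ Bad` whose weight
  is a fraction `ε` of the total (`ε·Σ_T a ≤ a τ₀`) bounds the bad class's relative weight by `1 − ε`.
* §3 **`exists_floor_of_continuousOn`** — THE TWO BY-FORM CARRIER FACTS ⟹ THE FLOOR: if every `t ↦ a t τ`,
  `τ ∈ T`, is continuous on `{t | |t| ≤ l₀}`, all weights are non-negative there and `a t τ₀ > 0`, then SOME
  `0 < ε ≤ 1` has `ε·Σ_T a t ≤ a t τ₀` for all `|t| ≤ l₀` (the source interval is compact: `IsCompact.exists_isMinOn`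
  on the continuous positive ratio; vacuous with `ε = 1` if `l₀ < 0`).
* §4 **`exists_relWeightBound_allK`** — ASSEMBLED: an eventual `RelWeightBound` + `Bad K t ⊆ T K` at every `K` +
  a never-bad term `τ₀ K` per cutoff, positive in BOTH runs at every `|t| ≤ l₀`, with source-continuous non-negative
  weights ⟹ `∃ W', RelWeightBound l₀ T A B Bad W' ∧ ∀ K ≥ K₀, W' K = W K` (the tail weights — hence NE7's tolerances
  `−log(1 − W K)∕vol` from `K₀` on — UNCHANGED; below `K₀`, `W' K = 1 − ε K < 1`).

NOT HERE (honest).  That Bałaban's expansions HAVE a never-bad («no large field anywhere») term of positive weight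
with source-continuous weights is a property of the carriers (true BY FORM for the cell's `(1.72)`-indexed families:
finitely many terms, each a finite-dimensional integral of a positive continuous density — but it is an INPUT here,
displayed as `hτ₀`, `hposA∕B`, `hcontA∕B`).  BY-NAME EFFECT ON THE WALL (`WALL-NE7b-P1.md` §2): NONE — a re-packaging
of NE7b's OUTPUT for its consumer.  NE7b NOT PRINTED, NOT PROVED; spine PROVED 0∕9; rung (B)+1 on a FINITE torus T⁴
— NOT infinite volume, NOT the mass gap, NOT Clay.  POLICY (ruling e34b3e0c): crux-route work of item (2) booked to
leaf-04 by the crux refuter (PRICING-NE7b v5 §R-H «outstanding cheap items»); NOT a `T4Continuum/Support` leaf.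
HONEST DEPENDENCY: continuum YM on T⁴ ⇐ BetaPertH ∧ nine spine estimates (0/9 proved); BetaPertH ⇐ (D1) ∧ (D4) ∧
CAP+tail; G-an2-4 gates asym, D1 and NE2/3/4.  This file changes none of it.
-/

set_option autoImplicit false

open Finset
open Literature.MathematicalPhysics.QuantumFieldTheory.Balaban1983to89
open Literature.MathematicalPhysics.QuantumFieldTheory.Balaban1983to89.T4WeightBudget

namespace Summit.QuantumFields.BalabanUV.T4Continuum.NE7b.WeightBudgetPrefix

/-! ## §1 An eventual `RelWeightBound` plus prefix weights is a `RelWeightBound` with `Bad` kept at every `K` -/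

section Prefix

variable {ι : Type*} {l₀ : ℝ} {T : ℕ → Finset ι} {A B : ℕ → ℝ → ι → ℝ} {Bad : ℕ → ℝ → Finset ι}
  {W W₀ : ℕ → ℝ} {K₀ : ℕ}

/-- **(R-K₀) THE PREFIX PATCH.**  An eventual `RelWeightBound` — bad classes emptied below `K₀`, any weight `W` (every
END of rows R-H ∕ COUNT has this shape via `T4WeightBudget.relWeightBound_of_eventually`) — together with, for each
`K < K₀`, the two relative bounds of the TRUE bad class `Bad K t ⊆ T K` by a prefix weight `0 ≤ W₀ K < 1`, is a
`RelWeightBound` with the bad classes KEPT AT EVERY CUTOFF and the weight `K ↦ if K₀ ≤ K then W K else W₀ K`.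
Summability is a tail property (`summable_nat_add_iff`). [folklore] -/
theorem relWeightBound_of_eventually_of_prefix
    (hW : RelWeightBound l₀ T A B (fun K t => if K₀ ≤ K then Bad K t else ∅) W)
    (hsub : ∀ K t, |t| ≤ l₀ → K < K₀ → Bad K t ⊆ T K)
    (h0 : ∀ K, K < K₀ → 0 ≤ W₀ K) (h1 : ∀ K, K < K₀ → W₀ K < 1)
    (hl : ∀ K t, |t| ≤ l₀ → K < K₀ → ∑ τ ∈ Bad K t, A K t τ ≤ W₀ K * ∑ τ ∈ T K, A K t τ)
    (hr : ∀ K t, |t| ≤ l₀ → K < K₀ → ∑ τ ∈ Bad K t, B K t τ ≤ W₀ K * ∑ τ ∈ T K, B K t τ) :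
    RelWeightBound l₀ T A B Bad (fun K => if K₀ ≤ K then W K else W₀ K) where
  bad_subset K t ht := by
    by_cases hK : K₀ ≤ K
    · have h := hW.bad_subset K t ht
      simp only [hK, if_true] at h
      exact h
    · exact hsub K t ht (Nat.lt_of_not_le hK)
  nonneg K := by
    by_cases hK : K₀ ≤ K
    · simp only [hK, if_true]; exact hW.nonneg K
    · simp only [hK, if_false]; exact h0 K (Nat.lt_of_not_le hK)
  lt_one K := by
    by_cases hK : K₀ ≤ K
    · simp only [hK, if_true]; exact hW.lt_one K
    · simp only [hK, if_false]; exact h1 K (Nat.lt_of_not_le hK)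
  summable := by
    refine (summable_nat_add_iff K₀).mp ?_
    refine ((summable_nat_add_iff K₀).mpr hW.summable).congr fun n => ?_
    simp only [Nat.le_add_left, if_true]
  bad_left K t ht := by
    by_cases hK : K₀ ≤ K
    · have h := hW.bad_left K t ht
      simp only [hK, if_true] at h ⊢
      exact h
    · simp only [hK, if_false]; exact hl K t ht (Nat.lt_of_not_le hK)
  bad_right K t ht := by
    by_cases hK : K₀ ≤ K
    · have h := hW.bad_right K t ht
      simp only [hK, if_true] at h ⊢
      exact h
    · simp only [hK, if_false]; exact hr K t ht (Nat.lt_of_not_le hK)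

/-- The same with the prefix facts stated at EVERY cutoff (the natural supplier — a never-bad term — does not know
`K₀`). [folklore] -/
theorem relWeightBound_of_eventually_of_floor
    (hW : RelWeightBound l₀ T A B (fun K t => if K₀ ≤ K then Bad K t else ∅) W)
    (hsub : ∀ K t, |t| ≤ l₀ → Bad K t ⊆ T K)
    (h0 : ∀ K, 0 ≤ W₀ K) (h1 : ∀ K, W₀ K < 1)
    (hl : ∀ K t, |t| ≤ l₀ → ∑ τ ∈ Bad K t, A K t τ ≤ W₀ K * ∑ τ ∈ T K, A K t τ)
    (hr : ∀ K t, |t| ≤ l₀ → ∑ τ ∈ Bad K t, B K t τ ≤ W₀ K * ∑ τ ∈ T K, B K t τ) :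
    RelWeightBound l₀ T A B Bad (fun K => if K₀ ≤ K then W K else W₀ K) :=
  relWeightBound_of_eventually_of_prefix hW (fun K t ht _ => hsub K t ht) (fun K _ => h0 K) (fun K _ => h1 K)
    (fun K t ht _ => hl K t ht) (fun K t ht _ => hr K t ht)

/-- The patched weight agrees with the eventual one on the tail `K ≥ K₀` (so NE7's tolerances `−log(1 − W K)∕vol`
are unchanged there). [folklore] -/
theorem prefixWeight_eq_of_le {K : ℕ} (hK : K₀ ≤ K) : (if K₀ ≤ K then W K else W₀ K) = W K := by
  simp only [hK, if_true]

end Prefix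

/-! ## §2 The trivial sup-ratio: a never-bad term of relative weight `ε` caps the bad class at `1 − ε` -/

section Floor

variable {ι : Type*}

/-- **THE TRIVIAL SUP-RATIO.**  If the bad class `Bad ⊆ T` misses a term `τ₀ ∈ T` whose weight is at least the
fraction `ε` of the (non-negative) total, `ε·Σ_T a ≤ a τ₀`, then `Σ_{Bad} a ≤ (1 − ε)·Σ_T a`. [folklore] -/
theorem sum_le_one_sub_mul_sum_of_floor {Bad T : Finset ι} {a : ι → ℝ} {ε : ℝ} (τ₀ : ι)
    (hsub : Bad ⊆ T) (hτ₀T : τ₀ ∈ T) (hτ₀ : τ₀ ∉ Bad) (ha : ∀ τ ∈ T, 0 ≤ a τ)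
    (hfloor : ε * ∑ τ ∈ T, a τ ≤ a τ₀) :
    ∑ τ ∈ Bad, a τ ≤ (1 - ε) * ∑ τ ∈ T, a τ := by
  classical
  have hsub' : Bad ⊆ T.erase τ₀ := fun τ hτ =>
    Finset.mem_erase.mpr ⟨fun h => hτ₀ (h ▸ hτ), hsub hτ⟩
  calc ∑ τ ∈ Bad, a τ ≤ ∑ τ ∈ T.erase τ₀, a τ :=
        Finset.sum_le_sum_of_subset_of_nonneg hsub' fun τ hτ _ => ha τ (Finset.mem_of_mem_erase hτ)
    _ = ∑ τ ∈ T, a τ - a τ₀ := Finset.sum_erase_eq_sub hτ₀T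
    _ ≤ ∑ τ ∈ T, a τ - ε * ∑ τ ∈ T, a τ := by linarith
    _ = (1 - ε) * ∑ τ ∈ T, a τ := by ring

/-- … so `W₀ := 1 − ε` is a prefix weight: `0 ≤ 1 − ε < 1` for `0 < ε ≤ 1`. [folklore] -/
theorem prefixWeight_bounds {ε : ℝ} (h0 : 0 < ε) (h1 : ε ≤ 1) : 0 ≤ 1 - ε ∧ 1 - ε < 1 :=
  ⟨by linarith, by linarith⟩

end Floor

/-! ## §3 The two by-form carrier facts (continuity in the source, a positive never-bad term) give the floor -/

section Compact

variable {ι : Type*} {l₀ : ℝ}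

/-- The source interval `{t | |t| ≤ l₀}` is the compact interval `[−l₀, l₀]`. [folklore] -/
theorem sourceSet_eq_Icc : {t : ℝ | |t| ≤ l₀} = Set.Icc (-l₀) l₀ :=
  Set.ext fun t => by rw [Set.mem_setOf_eq, Set.mem_Icc]; exact abs_le

/-- The source interval is compact. [folklore] -/
theorem isCompact_sourceSet : IsCompact {t : ℝ | |t| ≤ l₀} := by
  rw [sourceSet_eq_Icc]
  exact isCompact_Icc

/-- **THE FLOOR FROM THE TWO BY-FORM CARRIER FACTS** (the refuter's «`< 1` because the no-large-field term has
`A > 0` at every `|t| ≤ l₀` and `t ↦ A` is continuous on `[−l₀, l₀]`»).  For a finite family `T` of weights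
`a t τ` that are continuous in the source `t` on `{t | |t| ≤ l₀}` and non-negative there, and a term `τ₀ ∈ T` with
`a t τ₀ > 0` for all `|t| ≤ l₀`, SOME `0 < ε ≤ 1` satisfies `ε·Σ_{τ ∈ T} a t τ ≤ a t τ₀` for every `|t| ≤ l₀`
(the continuous positive ratio `a t τ₀ ∕ Σ_T a t` attains its minimum on the compact source interval; `ε = 1` if
the interval is empty). [folklore] -/
theorem exists_floor_of_continuousOn (T : Finset ι) (a : ℝ → ι → ℝ) {τ₀ : ι} (hτ₀ : τ₀ ∈ T)
    (hcont : ∀ τ ∈ T, ContinuousOn (fun t => a t τ) {t : ℝ | |t| ≤ l₀})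
    (ha : ∀ t : ℝ, |t| ≤ l₀ → ∀ τ ∈ T, 0 ≤ a t τ) (hpos : ∀ t : ℝ, |t| ≤ l₀ → 0 < a t τ₀) :
    ∃ ε : ℝ, 0 < ε ∧ ε ≤ 1 ∧ ∀ t : ℝ, |t| ≤ l₀ → ε * ∑ τ ∈ T, a t τ ≤ a t τ₀ := by
  set S : Set ℝ := {t : ℝ | |t| ≤ l₀} with hS
  -- the total dominates the never-bad term and is positive on the source interval
  have hle : ∀ t ∈ S, a t τ₀ ≤ ∑ τ ∈ T, a t τ := fun t ht =>
    Finset.single_le_sum (fun τ hτ => ha t ht τ hτ) hτ₀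
  have hDpos : ∀ t ∈ S, 0 < ∑ τ ∈ T, a t τ := fun t ht => (hpos t ht).trans_le (hle t ht)
  by_cases hne : S.Nonempty
  · -- the ratio is continuous on the compact source interval, hence attains a (positive) minimum
    have hD : ContinuousOn (fun t => ∑ τ ∈ T, a t τ) S := continuousOn_finsetSum T hcont
    have hf : ContinuousOn (fun t => a t τ₀ / ∑ τ ∈ T, a t τ) S :=
      (hcont τ₀ hτ₀).div hD fun t ht => (hDpos t ht).ne'
    obtain ⟨t₁, ht₁, hmin⟩ := isCompact_sourceSet.exists_isMinOn hne hf
    refine ⟨a t₁ τ₀ / ∑ τ ∈ T, a t₁ τ, div_pos (hpos t₁ ht₁) (hDpos t₁ ht₁),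
      (div_le_one (hDpos t₁ ht₁)).mpr (hle t₁ ht₁), fun t ht => ?_⟩
    have h := hmin ht
    simp only [Set.mem_setOf_eq] at h
    exact (le_div_iff₀ (hDpos t ht)).mp h
  · -- empty source interval: vacuous
    refine ⟨1, one_pos, le_rfl, fun t ht => ?_⟩
    exact absurd ⟨t, ht⟩ hne

end Compact

/-! ## §4 Assembled: an eventual `RelWeightBound` + a never-bad positive term per cutoff ⟹ `RelWeightBound` on all `K` -/

section Assembled

variable {ι : Type*} {l₀ : ℝ} {T : ℕ → Finset ι} {A B : ℕ → ℝ → ι → ℝ} {Bad : ℕ → ℝ → Finset ι}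
  {W : ℕ → ℝ} {K₀ : ℕ}

/-- **(R-K₀) WITH AN EXPLICIT FLOOR.**  An eventual `RelWeightBound` (any `W`, bad classes emptied below `K₀`) +
`Bad K t ⊆ T K` at every `K` + per cutoff a never-bad term `τ₀ K ∈ T K` carrying at least the fraction `0 < ε K ≤ 1`
of the total weight in BOTH runs, for every `|t| ≤ l₀` ⟹ `RelWeightBound l₀ T A B Bad` with the weight
`K ↦ if K₀ ≤ K then W K else 1 − ε K`: the bad classes KEPT at every cutoff. [folklore] -/
theorem relWeightBound_allK_of_floor {ε : ℕ → ℝ} (τ₀ : ℕ → ι)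
    (hW : RelWeightBound l₀ T A B (fun K t => if K₀ ≤ K then Bad K t else ∅) W)
    (hsub : ∀ K t, |t| ≤ l₀ → Bad K t ⊆ T K)
    (hA : ∀ K t, |t| ≤ l₀ → ∀ τ ∈ T K, 0 ≤ A K t τ) (hB : ∀ K t, |t| ≤ l₀ → ∀ τ ∈ T K, 0 ≤ B K t τ)
    (hτ₀T : ∀ K, τ₀ K ∈ T K) (hτ₀ : ∀ K t, |t| ≤ l₀ → τ₀ K ∉ Bad K t)
    (hε0 : ∀ K, 0 < ε K) (hε1 : ∀ K, ε K ≤ 1)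
    (hflA : ∀ K t, |t| ≤ l₀ → ε K * ∑ τ ∈ T K, A K t τ ≤ A K t (τ₀ K))
    (hflB : ∀ K t, |t| ≤ l₀ → ε K * ∑ τ ∈ T K, B K t τ ≤ B K t (τ₀ K)) :
    RelWeightBound l₀ T A B Bad (fun K => if K₀ ≤ K then W K else 1 - ε K) :=
  relWeightBound_of_eventually_of_floor hW hsub (fun K => (prefixWeight_bounds (hε0 K) (hε1 K)).1)
    (fun K => (prefixWeight_bounds (hε0 K) (hε1 K)).2)
    (fun K t ht => sum_le_one_sub_mul_sum_of_floor (τ₀ K) (hsub K t ht) (hτ₀T K) (hτ₀ K t ht) (hA K t ht)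
      (hflA K t ht))
    (fun K t ht => sum_le_one_sub_mul_sum_of_floor (τ₀ K) (hsub K t ht) (hτ₀T K) (hτ₀ K t ht) (hB K t ht)
      (hflB K t ht))

/-- **(R-K₀) ASSEMBLED FROM THE TWO BY-FORM CARRIER FACTS.**  An eventual `RelWeightBound` (any weight `W`, bad
classes emptied below `K₀`) + `Bad K t ⊆ T K` at every cutoff + per cutoff a NEVER-BAD term `τ₀ K ∈ T K` («no large
field anywhere») that is POSITIVE in both runs at every `|t| ≤ l₀`, all term weights non-negative and CONTINUOUS in
the source on `{t | |t| ≤ l₀}` ⟹ SOME weight `W'` gives `RelWeightBound l₀ T A B Bad W'` — the bad classes KEPT AT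
EVERY CUTOFF — with `W' K = W K` for `K ≥ K₀` (NE7's tolerances from `K₀` on unchanged; below `K₀` the weight is a
trivial sup-ratio `< 1`, and `hgood` is asked only OFF the bad class, as NE7b intends). [folklore] -/
theorem exists_relWeightBound_allK (τ₀ : ℕ → ι)
    (hW : RelWeightBound l₀ T A B (fun K t => if K₀ ≤ K then Bad K t else ∅) W)
    (hsub : ∀ K t, |t| ≤ l₀ → Bad K t ⊆ T K)
    (hA : ∀ K t, |t| ≤ l₀ → ∀ τ ∈ T K, 0 ≤ A K t τ) (hB : ∀ K t, |t| ≤ l₀ → ∀ τ ∈ T K, 0 ≤ B K t τ)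
    (hτ₀T : ∀ K, τ₀ K ∈ T K) (hτ₀ : ∀ K t, |t| ≤ l₀ → τ₀ K ∉ Bad K t)
    (hcontA : ∀ K, ∀ τ ∈ T K, ContinuousOn (fun t => A K t τ) {t : ℝ | |t| ≤ l₀})
    (hcontB : ∀ K, ∀ τ ∈ T K, ContinuousOn (fun t => B K t τ) {t : ℝ | |t| ≤ l₀})
    (hposA : ∀ K t, |t| ≤ l₀ → 0 < A K t (τ₀ K)) (hposB : ∀ K t, |t| ≤ l₀ → 0 < B K t (τ₀ K)) :
    ∃ W' : ℕ → ℝ, RelWeightBound l₀ T A B Bad W' ∧ ∀ K, K₀ ≤ K → W' K = W K := by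
  have hexA := fun K => exists_floor_of_continuousOn (T K) (A K) (hτ₀T K) (hcontA K) (hA K) (hposA K)
  have hexB := fun K => exists_floor_of_continuousOn (T K) (B K) (hτ₀T K) (hcontB K) (hB K) (hposB K)
  choose εA hεA0 hεA1 hεA using hexA
  choose εB hεB0 hεB1 hεB using hexB
  refine ⟨fun K => if K₀ ≤ K then W K else 1 - min (εA K) (εB K),
    relWeightBound_allK_of_floor τ₀ hW hsub hA hB hτ₀T hτ₀ (fun K => lt_min (hεA0 K) (hεB0 K))
      (fun K => (min_le_left _ _).trans (hεA1 K)) (fun K t ht => ?_) (fun K t ht => ?_),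
    fun K hK => by simp only [hK, if_true]⟩
  · exact (mul_le_mul_of_nonneg_right (min_le_left _ _)
      (Finset.sum_nonneg fun τ hτ => hA K t ht τ hτ)).trans (hεA K t ht)
  · exact (mul_le_mul_of_nonneg_right (min_le_right _ _)
      (Finset.sum_nonneg fun τ hτ => hB K t ht τ hτ)).trans (hεB K t ht)

end Assembled

end Summit.QuantumFields.BalabanUV.T4Continuum.NE7b.WeightBudgetPrefix
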